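import Mathlib
import HarnessLib
import Summits.CriticalPhenomena.CardyFormulaZ2.Theses.CardyMagicRigidity
import Literature.Probability.Percolation.FullPlaneCNL
import Literature.Probability.RandomPlanarGeometry.NestingTransform

/-!
# Sketch — crux-ideate `stmt-CriticalPhenomena-4836` (`CardyMagicRigidity.MagicFormulaT`),
ideator 2 (generation 2), round 1.

First-lemma signatures of card `kac-window-vertex-operators` and of the evidence note
`AdiabaticSectorNote.md`, over existing declarations only. The arithmetic identities of §1 are
PROVED (they are the "Kac table on the BKW charge lattice" observation the card rests on);
everything in §§2–3 is a `def … : Prop` that must merely elaborate.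
-/

noncomputable section

namespace Summit.CriticalPhenomena.CardyFormulaZ2.Cruxes.MagicFormulaT.SketchIdeator2G2

open MeasureTheory Filter Finset
open scoped Real Topology BigOperators
open Literature.Probability.RandomPlanarGeometry Literature.Probability.Percolation
  Literature.Probability.LatticeModels

/-! ## §1  The Gaussian dimension on the charge lattice `(π/3)ℤ` is the arm spectrum / Kac table -/

/-- The Gaussian ("magic") scaling dimension of the twisted nesting insertion of charge `λ`:
`Δ_G(λ) = λ/2π + 3λ²/4π²` — the leading Schramm–Sheffield–Wilson nesting exponent of CLE₆ for the
loop weight `2cos(λ + π/3)` on the window `λ ∈ [-4π/3, 2π/3]`, and the `c = 0` Coulomb-gas dimension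
of the electric charge `e = -λ/π` (`g = 2/3`, `e₀ = 1/3`). -/
def gaussDim (lam : ℝ) : ℝ := lam / (2 * π) + 3 * lam ^ 2 / (4 * π ^ 2)

/-- The integer loop weight carried by a sixth-root charge: `w(λ) = 2cos(λ + π/3)`. -/
def loopWeight (lam : ℝ) : ℝ := 2 * Real.cos (lam + π / 3)

/-- Polychromatic `L`-arm exponent of planar percolation, `x_L = (L² - 1)/12` (`L ≥ 2`; `x₀ = -1/12`
is the "puncture", `x₁ = 0` the identity). -/
def armExponent (L : ℕ) : ℝ := ((L : ℝ) ^ 2 - 1) / 12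

/-- Twice the `c = 0` Kac weight, `2 h_{r,s} = ((3r - 2s)² - 1)/12`. -/
def kacTwice (r s : ℤ) : ℝ := (((3 * r - 2 * s : ℤ) : ℝ) ^ 2 - 1) / 12

/-- **On the BKW charge lattice the Gaussian dimension is a perfect square law:**
`Δ_G(mπ/3) = ((m+1)² - 1)/12`. -/
theorem gaussDim_sixth_root (m : ℝ) : gaussDim (m * (π / 3)) = ((m + 1) ^ 2 - 1) / 12 := by
  unfold gaussDim
  have hπ : (π : ℝ) ≠ 0 := Real.pi_ne_zero
  field_simp
  ring

/-- **Arm spectrum = Gaussian dimensions of sixth-root charges (κ = 6 only, since g/2 = e₀):**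
`Δ_G((L-1)π/3) = Δ_G(-(L+1)π/3) = x_L`. E.g. hull `x₂ = 1/4 = Δ_G(π/3) = Δ_G(-π)`,
3-arm `x₃ = 2/3 = Δ_G(2π/3)`, pinch `x₄ = 5/4 = Δ_G(π)`, `x₅ = 2 = Δ_G(4π/3) = Δ_G(-2π)`. -/
theorem gaussDim_arm (L : ℕ) :
    gaussDim (((L : ℝ) - 1) * (π / 3)) = armExponent L ∧
      gaussDim (-((L : ℝ) + 1) * (π / 3)) = armExponent L := by
  refine ⟨?_, ?_⟩ <;> rw [gaussDim_sixth_root] <;> unfold armExponent <;> ring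

/-- The loop weight of the charge `(L-1)π/3` is the integer `2cos(πL/3) ∈ {2, 1, -1, -2}`. -/
theorem loopWeight_arm (L : ℕ) : loopWeight (((L : ℝ) - 1) * (π / 3)) = 2 * Real.cos (L * π / 3) := by
  unfold loopWeight
  congr 1
  ring_nf

/-- **Kac table:** if `3r - 2s = ±(m+1)` then `Δ_G(mπ/3) = 2 h_{r,s}`; every `m` is hit
(`|3r-2s|` ranges over all of `ℕ`), e.g. `λ = π/3 ↔ h_{2,2} = 1/8`, `λ = π ↔ h_{2,1} = 5/8`,
`λ = 2π/3 ↔ h_{1,3} = 1/3`, `λ = -π/3 ↔ h_{2,3} = -1/24`, `λ = 4π/3 ↔ h_{1,4} = 1`, `λ = 2π ↔ h_{3,1} = 2`. -/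
theorem gaussDim_eq_kacTwice (m r s : ℤ) (h : 3 * r - 2 * s = m + 1 ∨ 3 * r - 2 * s = -(m + 1)) :
    gaussDim (m * (π / 3)) = kacTwice r s := by
  rw [gaussDim_sixth_root]
  unfold kacTwice
  rcases h with h | h <;> rw [h] <;> push_cast <;> ring

/-- The two `w = 1` charges `0` and `λ* = -2π/3` (identity and conjugate identity) have dimension `0`. -/
theorem gaussDim_conjugate_identity : gaussDim 0 = 0 ∧ gaussDim (-(2 * π / 3)) = 0 := by
  have h1 : gaussDim 0 = 0 := by unfold gaussDim; simp
  have h2 : gaussDim (-(2 * π / 3)) = 0 := by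
    have := gaussDim_sixth_root (-2)
    norm_num at this
    convert this using 2
    ring
  exact ⟨h1, h2⟩

/-! ## §2  Card `kac-window-vertex-operators`: atomic charges as scaling fields on site-𝕋 -/

/-- Weight of a lattice loop `u` in the presence of `k` atomic charges `λ_j` at `z_j`: charges inside
the loop (non-zero winding number) ADD, `w = 2cos(Σ_{z_j ∈ int u} λ_j + π/3)` (direct, single-channel
fusion — the structural reason the conjugate Coulomb-gas channel never appears). -/
def atomicWeight (k : ℕ) (z : Fin k → ℂ) (lam : Fin k → ℝ) (u : UnbasedLoop ℂ) : ℝ :=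
  2 * Real.cos ((∑ j, if u.wind (z j) ≠ 0 then lam j else 0) + π / 3)

/-- The atomic twisted transform of site-𝕋 percolation at mesh `δ`:
`G_δ(z; λ) = E_{1/2}[∏_{interface loops u of δ𝕋} 2cos(Σ_{z_j ∈ int u} λ_j + π/3)]`
(a finite product: loops surrounding all or none of the `z_j` weigh `1` when `Σ λ_j = 0`). -/
def atomicTransformT (k : ℕ) (z : Fin k → ℂ) (lam : Fin k → ℝ) (δ : ℝ) : ℝ :=
  ∫ cfg, (∏ᶠ u ∈ (siteLoopConfig δ cfg).loops, atomicWeight k z lam u) ∂(triSitePercolation half)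

/-- The free-field (screening-free Coulomb gas with the conjugate vacuum at `∞`) shape factor
`∏_{i<j} |z_i - z_j|^{2kλ_iλ_j}`, `k = 3/4π²`. -/
def freeFieldShape (k : ℕ) (z : Fin k → ℂ) (lam : Fin k → ℝ) : ℝ :=
  Real.exp (∑ i, ∑ j, if i < j then 2 * (3 / (4 * π ^ 2)) * lam i * lam j * Real.log ‖z i - z j‖ else 0)

/-- All subset sums of the charges lie strictly inside the SSW window `(-4π/3, 2π/3)`: then every
fused insertion keeps the Gaussian branch as its LEADING renewal branch and avoids the logarithmic
(`w = -2`, double-root) point `2π/3`. -/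
def InWindow (k : ℕ) (lam : Fin k → ℝ) : Prop :=
  ∀ S : Finset (Fin k), S.Nonempty → (∑ j ∈ S, lam j) ∈ Set.Ioo (-(4 * π / 3)) (2 * π / 3)

/-- **First lemma of the card (ratio rigidity of window vertex correlators).** For neutral charges
in the window, ratios of atomic transforms between two configurations converge to the free-field
ratio: the UV renormalisation is a configuration-independent product of one-point constants.
(Order 2 is automatic by covariance; the content starts at `k = 3` because the functional is NOT
Möbius-primary — the conjugate identity sits at `∞` — so the pair exponents `2kλ_iλ_j` are a
genuine prediction, e.g. `(π/2,-π/4,-π/4)`: `|z₂₃|^{+3/32}` against the naive primary form `|z₂₃|^{+19/32}`.)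
MC: kit jobs j013725 / j013729 of this unit. -/
def AtomicRatioRigidity : Prop :=
  ∀ (k : ℕ) (z z' : Fin k → ℂ) (lam : Fin k → ℝ), Function.Injective z → Function.Injective z' →
    ∑ j, lam j = 0 → InWindow k lam →
      Tendsto (fun δ : ℝ ↦ atomicTransformT k z lam δ / atomicTransformT k z' lam δ) (𝓝[>] 0)
        (𝓝 (freeFieldShape k z lam / freeFieldShape k z' lam))

/-- **Atomic magic formula (vertex operators are free fields with multiplicative UV constants):**
there is a one-point renormalisation `c(λ, δ)` (independent of `k` and of the configuration) with
`G_δ(z; λ) / (∏_j c(λ_j, δ) · ∏_{i<j}|z_ij|^{2kλ_iλ_j}) → 1`. This is the card's `C⁺` core on the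
whole window; on the sixth-root sublattice the insertions are the arm operators (hull, pinch, 3-arm,
puncture …), i.e. `c = 0` Kac fields. -/
def AtomicMagicT : Prop :=
  ∃ c : ℝ → ℝ → ℝ, ∀ (k : ℕ) (z : Fin k → ℂ) (lam : Fin k → ℝ), Function.Injective z →
    ∑ j, lam j = 0 → InWindow k lam →
      Tendsto (fun δ : ℝ ↦ atomicTransformT k z lam δ / ((∏ j, c (lam j) δ) * freeFieldShape k z lam))
        (𝓝[>] 0) (𝓝 1)

/-- The smearing transfer (moments/vertex correlators ⇒ characteristic functional of bounded neutral
densities; shape of DKLM Thm "criterion" + dominated convergence with `|∏ cos_μ| ≤ 2^N`): the step that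
returns the crux from the atomic statement. Stated as the implication to be proved. -/
def SmearingTransfer : Prop :=
  AtomicMagicT → Summit.CriticalPhenomena.CardyFormulaZ2.Theses.CardyMagicRigidity.MagicFormulaT

/-! ## §3  Evidence note `AdiabaticSectorNote.md`: the radial log-adiabatic sector (all orders, from SSW) -/

/-- The radial, log-scale-adiabatic neutral density built from an axial profile `g`:
`f_M(z) = g(log‖z‖/M) / (2π M ‖z‖²)` (so that the charge below log-radius `s` is `G(s/M)`,
`G(u) = ∫_{-∞}^u g`). Bounded and compactly supported in an annulus when `g` is. -/
def radialProfile (g : ℝ → ℝ) (M : ℝ) (z : ℂ) : ℝ :=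
  g (Real.log ‖z‖ / M) / (2 * π * M * ‖z‖ ^ 2)

/-- The `δ → 0⁺` limit of the site-𝕋 lattice transform (an unspecified real if it does not exist). -/
def latticeLimitT (f : ℂ → ℝ) : ℝ :=
  limUnder (𝓝[>] (0 : ℝ)) fun δ : ℝ ↦ ∫ cfg, (siteLoopConfig δ cfg).nestingWeight f ∂(triSitePercolation half)

/-- **Adiabatic-sector magic formula (LDP level), a corollary-candidate of SSW's nesting law:** the
renewal growth rate of weight `2cos(F+π/3)` is EXACTLY `-F/2π - 3F²/4π²`, the linear part is the
conformal anomaly and is cancelled in the plane by the contractible loops, so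
`(1/M) log Λ^𝕋(f_M) → -(3/4π²) ∫ G(u)² du` — the Gaussian value `(3/4π²)∬ log|z-w| f_M f_M = -(3/4π²) M ∫ G²`
to leading order. -/
def RadialAdiabaticMagicT : Prop :=
  ∀ g : ℝ → ℝ, ContDiff ℝ ⊤ g → HasCompactSupport g → ∫ s, g s = 0 →
    Tendsto (fun M : ℝ ↦ (1 / M) * Real.log (latticeLimitT (radialProfile g M))) atTop
      (𝓝 (-(3 / (4 * π ^ 2)) * ∫ u, (∫ t in Set.Iic u, g t) ^ 2))

end Summit.CriticalPhenomena.CardyFormulaZ2.Cruxes.MagicFormulaT.SketchIdeator2G2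

end
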